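import Summits.QuantumFields.BalabanUV.T4Continuum.Support.B13AvgCorrRefine
import Summits.QuantumFields.BalabanUV.T4Continuum.Support.B13AvgCorrStokesVariation

/-!
# B13AvgCorrRefineVariation — row NE5, σ road (J-avg-reg SECOND ORDER: owner R60 `HOME/CLAIMS.log` l.24769, INTENT g39-d l.24783, T4-DAG Q52
# l.24813, memo `t4/T4-EST-NE5-JAVG-SECOND.md` §4 row P1-c), brick σ-L3 «THE REFINED-LOOP FACTORISATION FOR DIFFERENCES»:
# the ONE-DIFFERENCE twin of κ-L3 `B13AvgCorrRefine` (and of W-25a `SubstrateAvgTowerStructure` §1–§2) — the two-field quotients of the conjugated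
# correction products `conjAcc` ∕ `corrHol`, of the straight factors `pprod` ∕ `axialTower`, of the accumulated correction `corrAcc`, and of the (0.4)
# loop variables of the averaging tower, for TWO finest configurations `V`, `V′`

Cell `pub-balaban`, NE5 formalisation swarm, unit `b2b-balaban-t4-ne5-formalise-leaf-03` (gen 21; CLAIM + INTENT journal l.25089).  Summits-side NEW
WORK under the LEAN PLACEMENT RULE: [folklore] group algebra in an abstract `[GaugeGroup G]` on OUR tower objects; 0 `def`, no `Prop`-valued fact
minted, nothing printed asserted, no citation tag.  HONEST FRAMING: rung (B)+1 of the FINITE-VOLUME T⁴ programme — NOT infinite volume, NOT a mass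
gap, NOT the Clay problem, NOT a proof of NE5 (NOT PRINTED; GAPS G-t4-U3-1); nothing of [Balaban1985Averaging] Props 5–10 ∕ [Balaban1985BackgroundPropagators]
(3.36) is instantiated, asserted or discharged; the (ℓ2)(ℓ4) letters of J-avg-reg stay DISPLAYED until σ-W ∕ σ-L1 ∕ σ-L2 ∕ σ-L4 ∕ σ-END all exist.
HONEST DEPENDENCY (cell, verbatim): continuum YM on T⁴ ⇐ BetaPertH ∧ nine spine estimates (0/9 proved); BetaPertH ⇐ (D1) ∧ (D4) ∧ CAP+tail;
G-an2-4 gates asym, D1 and NE2/3/4.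

WHY.  The first-difference correction letter of the σ road ((C1) of the memo, `ρ₁` of g39-d: `‖corr(c + e_ν) − corr(c)‖·ℓ³ ≤ κ₁`) is reached, on
κ-END's road one derivative up, from the two-field quotient `dist1 (loopHol U′_i c r · (loopHol U_i c r)⁻¹)` of the (0.4) loop variables of the
averaging towers `U_i = avgTower ℰ V i`, `U′_i = avgTower ℰ V′ i` of two finest fields (`V′` = the translate of `V` is ONE instance), which σ-L4
(`B13AvgCorrEmlVariation`, leaf-06) turns into the quotient of the correction factors.  By κ-L3 (`B13AvgCorrRefine.loopHol_avgTower_eq`) each loop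
variable is `corrHol (corrAcc ℰ V i) (axialTower V i) γ · holAt V (refined loop word)`; σ-L1 FILE 2 (`B13AvgCorrStokesVariationLoop`, leaf-10) bounds the
two-field quotient of the SECOND factor (Stokes for differences on one lattice); THIS FILE bounds the two-field quotient of the FIRST factor and of
its ingredients, under σ-L1's one displayed commutator hypothesis `hcomm : ∀ a b, dist1 (a·b·a⁻¹·b⁻¹) ≤ 2·dist1 a·dist1 b` (true in unitary matrix
models: κ-L2 `B13AvgCorrPlaquette.norm_commutator_le`).
* §1 (ℕ-indexed, W-25a's objects): `dist1_pprod_quot_le` (`dist1 (Π′·Π⁻¹) ≤ Σ_{t<n} dist1 (A′_t A_t⁻¹)`), **`dist1_conjAcc_quot_le`**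
  (`dist1 (conjAcc C′ A′ n · (conjAcc C A n)⁻¹) ≤ Σ_{t<n} (dist1 (C′_t C_t⁻¹) + 2·dist1 C_t·dist1 (Π′_t Π_t⁻¹))`) and its uniform face
  `dist1_conjAcc_quot_le_of_forall` (`≤ n·t_C + 2·a·t_A·n²`).
* §2 (step lists, κ-L3's `corrHol`): the one-step recursion `dist1_corrHol_quot_cons_le` (forward AND backward letters:
  `≤ t_C + 2·t_A·(a + dist1 (corrHol C A γ)) + (quotient of the tail)`) and **`dist1_corrHol_quot_le`**
  (`≤ |γ|·t_C + t_A·a·(|γ|·(|γ|+1))` under `dist1 (C b) ≤ a`, `dist1 (C′ b·(C b)⁻¹) ≤ t_C`, `dist1 (A′ b·(A b)⁻¹) ≤ t_A`), monotone in `|γ| ≤ n`.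
* §3 (tower letters): `dist1_axialTower_quot_le` (`≤ L^j·t₀` from a finest bond-variation letter `t₀`), `dist1_pathProd_quot_le`, and the
  **`corrAcc` ONE-STEP VARIATION RECURSION** `dist1_corrAcc_succ_quot_le` (sum form) ∕ `dist1_corrAcc_succ_quot_le_of_forall`
  (`≤ dist1 (corr′_j c·(corr_j c)⁻¹) + L·E_j + 2·a_j·(L^j·t₀)·L²`) — the twin of W-25a `dist1_corrAcc_succ_le` — and its accumulated, def-free form
  **`dist1_corrAcc_quot_le_of_rec`** (any majorant `E` of the recursion `κ₁ j + L·E j + 2·a_j·(L^j·t₀)·L² ≤ E (j+1)` bounds the level-`j` variation).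
* §4 END at the averaging tower: **`dist1_loopHol_avgTower_quot_le`** (`≤ dist1 (corrHol′·corrHol⁻¹) + dist1 (holAt V′ ρ·(holAt V ρ)⁻¹)`, `ρ` the
  refined loop walk of κ-L3) and the uniform face **`dist1_loopHol_avgTower_quot_le_of_forall`**
  (`≤ (d+2)L·t_C + t_A·a·((d+2)L·((d+2)L+1)) + Δ`, `Δ` the refined-word quotient — DISPLAYED; σ-L1 FILE 2's END is applied to it by the σ-END holder
  exactly as κ-END applies κ-L1).
Inputs BY NAME: σ-L1 file 1 `B13AvgCorrStokesVariation.dist1_quot_mul_le ∕ dist1_conj_quot_le ∕ dist1_inv_mul_eq ∕ dist1_holAt_walk_two_le`, κ-L3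
`B13AvgCorrRefine.corrHol* ∕ dist1_corrHol_le_of_forall ∕ loopHol_avgTower_eq ∕ length_loopWord_off_le ∕ axialTower_eq_holAt_walk`, W-25a
`SubstrateAvgTowerStructure.pprod ∕ conjAcc ∕ corrAcc_succ ∕ pathProd_eq_pprod`, `T4AvgDerivBound.length_walk`.
0 sorry; axioms ⊆ {propext, Classical.choice, Quot.sound}.
-/

noncomputable section

open scoped BigOperators

namespace Summit.QuantumFields.BalabanUV.T4Continuum.B13AvgCorrRefineVariation

open Literature.MathematicalPhysics.QuantumFieldTheory.Balaban1983to89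
open Literature.MathematicalPhysics.QuantumFieldTheory.Balaban1983to89.T4Continuum (LStep walk holAt loopWord holAt_nil holAt_cons)
open Literature.MathematicalPhysics.QuantumFieldTheory.Balaban1983to89.BlockAveraging (Idx off loopHol corr)
open Literature.MathematicalPhysics.QuantumFieldTheory.Balaban1983to89.AveragingRT (line pathProd)
open Summit.QuantumFields.BalabanUV.T4Continuum.SubstrateAvgTowerStructure (pprod conjAcc corrAcc avgTower axialTower pprod_zero pprod_succ
  conjAcc_zero conjAcc_succ corrAcc_succ pathProd_eq_pprod)
open Summit.QuantumFields.BalabanUV.T4Continuum.B13AvgCorrRefine (corrHol corrHol_nil corrHol_cons_true corrHol_cons_false dist1_corrHol_le_of_forall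
  embIter loopHol_avgTower_eq length_loopWord_off_le axialTower_eq_holAt_walk)
open Summit.QuantumFields.BalabanUV.T4Continuum.B13AvgCorrStokesVariation (dist1_quot_mul_le dist1_quot_inv dist1_inv_mul_eq dist1_conj_quot_le
  dist1_holAt_walk_two_le)

/-! ## §1 The two-field quotients of partial products and of the conjugated accumulation (W-25a §1's objects) -/

section Group

variable {G : Type*} [GaugeGroup G]

/-- [folklore] **TELESCOPING**: `dist1 (pprod A′ n · (pprod A n)⁻¹) ≤ Σ_{t<n} dist1 (A′_t·A_t⁻¹)`. -/
theorem dist1_pprod_quot_le (A A' : ℕ → G) : ∀ n, dist1 (pprod A' n * (pprod A n)⁻¹) ≤ ∑ t ∈ Finset.range n, dist1 (A' t * (A t)⁻¹)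
  | 0 => by rw [pprod_zero, pprod_zero, inv_one, mul_one, GaugeGroup.dist1_one, Finset.sum_range_zero]
  | n + 1 => by
      rw [pprod_succ, pprod_succ, Finset.sum_range_succ]
      exact (dist1_quot_mul_le _ _ _ _).trans (add_le_add (dist1_pprod_quot_le A A' n) le_rfl)

/-- [folklore] **THE TWO-FIELD QUOTIENT OF THE CONJUGATED ACCUMULATION** (sum form): under the commutator hypothesis,
`dist1 (conjAcc C′ A′ n · (conjAcc C A n)⁻¹) ≤ Σ_{t<n} (dist1 (C′_t·C_t⁻¹) + 2·dist1 C_t·dist1 (Π′_t·Π_t⁻¹))`, `Π_t = pprod A t` — each factor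
`Π_t C_t Π_t⁻¹` read in the two fields costs its own variation plus a commutator of `C_t` with the variation of its conjugator. -/
theorem dist1_conjAcc_quot_le (hcomm : ∀ a b : G, dist1 (a * b * a⁻¹ * b⁻¹) ≤ 2 * dist1 a * dist1 b) (C C' A A' : ℕ → G) :
    ∀ n, dist1 (conjAcc C' A' n * (conjAcc C A n)⁻¹) ≤
      ∑ t ∈ Finset.range n, (dist1 (C' t * (C t)⁻¹) + 2 * dist1 (C t) * dist1 (pprod A' t * (pprod A t)⁻¹))
  | 0 => by rw [conjAcc_zero, conjAcc_zero, inv_one, mul_one, GaugeGroup.dist1_one, Finset.sum_range_zero]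
  | n + 1 => by
      rw [conjAcc_succ, conjAcc_succ, Finset.sum_range_succ]
      exact (dist1_quot_mul_le _ _ _ _).trans
        (add_le_add (dist1_conjAcc_quot_le hcomm C C' A A' n) (dist1_conj_quot_le hcomm _ _ _ _))

/-- [folklore] **… uniform face**: `dist1 (C_t) ≤ a`, `dist1 (C′_t·C_t⁻¹) ≤ t_C`, `dist1 (A′_t·A_t⁻¹) ≤ t_A` for `t < n` give
`dist1 (conjAcc C′ A′ n · (conjAcc C A n)⁻¹) ≤ n·t_C + 2·a·t_A·n²` (the straight quotients telescope to `≤ t·t_A ≤ n·t_A`). -/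
theorem dist1_conjAcc_quot_le_of_forall (hcomm : ∀ a b : G, dist1 (a * b * a⁻¹ * b⁻¹) ≤ 2 * dist1 a * dist1 b) (C C' A A' : ℕ → G) (n : ℕ)
    {a tC tA : ℝ} (ha0 : 0 ≤ a) (htA0 : 0 ≤ tA) (hC : ∀ t < n, dist1 (C t) ≤ a) (hC' : ∀ t < n, dist1 (C' t * (C t)⁻¹) ≤ tC)
    (hA : ∀ t < n, dist1 (A' t * (A t)⁻¹) ≤ tA) :
    dist1 (conjAcc C' A' n * (conjAcc C A n)⁻¹) ≤ n * tC + 2 * a * tA * n ^ 2 := by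
  refine (dist1_conjAcc_quot_le hcomm C C' A A' n).trans ?_
  have hP : ∀ t < n, dist1 (pprod A' t * (pprod A t)⁻¹) ≤ n * tA := by
    intro t ht
    refine (dist1_pprod_quot_le A A' t).trans ?_
    calc ∑ s ∈ Finset.range t, dist1 (A' s * (A s)⁻¹) ≤ ∑ _s ∈ Finset.range t, tA :=
          Finset.sum_le_sum fun s hs => hA s ((Finset.mem_range.1 hs).trans ht)
      _ = t * tA := by rw [Finset.sum_const, Finset.card_range, nsmul_eq_mul]
      _ ≤ n * tA := mul_le_mul_of_nonneg_right (by exact_mod_cast ht.le) htA0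
  calc ∑ t ∈ Finset.range n, (dist1 (C' t * (C t)⁻¹) + 2 * dist1 (C t) * dist1 (pprod A' t * (pprod A t)⁻¹))
      ≤ ∑ _t ∈ Finset.range n, (tC + 2 * a * (n * tA)) := by
        refine Finset.sum_le_sum fun t ht => ?_
        have ht' := Finset.mem_range.1 ht
        have h1 := hC' t ht'
        have h2 : 2 * dist1 (C t) * dist1 (pprod A' t * (pprod A t)⁻¹) ≤ 2 * a * (n * tA) := by
          have := hC t ht'
          have := hP t ht'
          have : 0 ≤ dist1 (pprod A' t * (pprod A t)⁻¹) := GaugeGroup.dist1_nonneg _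
          have : 0 ≤ dist1 (C t) := GaugeGroup.dist1_nonneg _
          gcongr
        linarith
    _ = n * tC + 2 * a * tA * n ^ 2 := by rw [Finset.sum_const, Finset.card_range, nsmul_eq_mul]; ring

end Group

/-! ## §2 The two-field quotient of κ-L3's conjugated correction product along a step list -/

section Steps

variable {P : Params} {j : ℕ} {G : Type*} [GaugeGroup G]
  (hcomm : ∀ a b : G, dist1 (a * b * a⁻¹ * b⁻¹) ≤ 2 * dist1 a * dist1 b)
include hcomm

/-- [folklore] **ONE STEP OF THE RECURSION** (forward or backward letter): with `K = corrHol C A γ` the tail,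
`dist1 (corrHol C′ A′ (s :: γ) · (corrHol C A (s :: γ))⁻¹) ≤ dist1 (C′ b·(C b)⁻¹) + 2·dist1 (A′ b·(A b)⁻¹)·(dist1 (C b) + dist1 K) + dist1 (K′·K⁻¹)`,
`b = s.bond`.  Forward: `corrHol = C_b · (A_b K A_b⁻¹)`; backward: `corrHol = A_b⁻¹ (C_b⁻¹ K) A_b`, a conjugate of `P = C_b⁻¹K` by `A_b⁻¹`,
`dist1 P ≤ dist1 C_b + dist1 K`, `dist1 (P′P⁻¹) ≤ dist1 (C′_b C_b⁻¹) + dist1 (K′K⁻¹)`. -/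
theorem dist1_corrHol_quot_cons_le (C C' A A' : GaugeField P j G) (s : LStep P j) (γ : List (LStep P j)) :
    dist1 (corrHol C' A' (s :: γ) * (corrHol C A (s :: γ))⁻¹) ≤
      dist1 (C' s.bond * (C s.bond)⁻¹) + 2 * dist1 (A' s.bond * (A s.bond)⁻¹) * (dist1 (C s.bond) + dist1 (corrHol C A γ)) +
        dist1 (corrHol C' A' γ * (corrHol C A γ)⁻¹) := by
  obtain ⟨b, fwd⟩ := s
  have hA0 : 0 ≤ dist1 (A' b * (A b)⁻¹) := GaugeGroup.dist1_nonneg _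
  have hCb0 : 0 ≤ dist1 (C b) := GaugeGroup.dist1_nonneg _
  cases fwd
  · -- backward letter
    rw [corrHol_cons_false, corrHol_cons_false]
    have e : (A' b)⁻¹ * (C' b)⁻¹ * corrHol C' A' γ * A' b * ((A b)⁻¹ * (C b)⁻¹ * corrHol C A γ * A b)⁻¹ =
        (A' b)⁻¹ * ((C' b)⁻¹ * corrHol C' A' γ) * (A' b)⁻¹⁻¹ * ((A b)⁻¹ * ((C b)⁻¹ * corrHol C A γ) * (A b)⁻¹⁻¹)⁻¹ := by group
    rw [e]
    refine (dist1_conj_quot_le hcomm _ _ _ _).trans ?_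
    rw [dist1_quot_inv]
    have h1 : dist1 ((C' b)⁻¹ * corrHol C' A' γ * ((C b)⁻¹ * corrHol C A γ)⁻¹) ≤
        dist1 (C' b * (C b)⁻¹) + dist1 (corrHol C' A' γ * (corrHol C A γ)⁻¹) := by
      refine (dist1_quot_mul_le _ _ _ _).trans ?_
      rw [dist1_quot_inv]
    have h2 : dist1 ((C b)⁻¹ * corrHol C A γ) ≤ dist1 (C b) + dist1 (corrHol C A γ) :=
      (GaugeGroup.dist1_mul_le _ _).trans (by rw [GaugeGroup.dist1_inv])
    nlinarith [GaugeGroup.dist1_nonneg (corrHol C A γ)]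
  · -- forward letter
    rw [corrHol_cons_true, corrHol_cons_true]
    have e : C' b * A' b * corrHol C' A' γ * (A' b)⁻¹ * (C b * A b * corrHol C A γ * (A b)⁻¹)⁻¹ =
        C' b * (A' b * corrHol C' A' γ * (A' b)⁻¹) * (C b * (A b * corrHol C A γ * (A b)⁻¹))⁻¹ := by group
    rw [e]
    refine (dist1_quot_mul_le _ _ _ _).trans ?_
    have h1 := dist1_conj_quot_le hcomm (corrHol C A γ) (corrHol C' A' γ) (A b) (A' b)
    nlinarith [GaugeGroup.dist1_nonneg (corrHol C A γ)]

/-- [folklore] **THE TWO-FIELD QUOTIENT OF THE CONJUGATED CORRECTION PRODUCT** (κ-L3's `corrHol`, any step list): under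
`dist1 (C b) ≤ a`, `dist1 (C′ b·(C b)⁻¹) ≤ t_C`, `dist1 (A′ b·(A b)⁻¹) ≤ t_A` for all bonds,
`dist1 (corrHol C′ A′ γ · (corrHol C A γ)⁻¹) ≤ |γ|·t_C + t_A·a·(|γ|·(|γ|+1))` (the tail met at the `k`-th letter from the end has `dist1 ≤ k·a`,
κ-L3 `dist1_corrHol_le_of_forall`). -/
theorem dist1_corrHol_quot_le (C C' A A' : GaugeField P j G) {a tC tA : ℝ} (hC : ∀ b, dist1 (C b) ≤ a)
    (hC' : ∀ b, dist1 (C' b * (C b)⁻¹) ≤ tC) (hA : ∀ b, dist1 (A' b * (A b)⁻¹) ≤ tA) :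
    ∀ γ : List (LStep P j), dist1 (corrHol C' A' γ * (corrHol C A γ)⁻¹) ≤
      (γ.length : ℝ) * tC + tA * a * ((γ.length : ℝ) * (γ.length + 1))
  | [] => by simp [corrHol_nil, GaugeGroup.dist1_one]
  | s :: γ => by
      have htA0 : 0 ≤ tA := (GaugeGroup.dist1_nonneg _).trans (hA s.bond)
      have IH := dist1_corrHol_quot_le C C' A A' hC hC' hA γ
      have hK : dist1 (corrHol C A γ) ≤ (γ.length : ℝ) * a := dist1_corrHol_le_of_forall C A hC γ
      have hstep := dist1_corrHol_quot_cons_le hcomm C C' A A' s γ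
      have h2 : 2 * dist1 (A' s.bond * (A s.bond)⁻¹) * (dist1 (C s.bond) + dist1 (corrHol C A γ)) ≤ 2 * tA * (a + γ.length * a) := by
        have := hC s.bond
        have : 0 ≤ dist1 (C s.bond) + dist1 (corrHol C A γ) := add_nonneg (GaugeGroup.dist1_nonneg _) (GaugeGroup.dist1_nonneg _)
        have := hA s.bond
        have hsum : dist1 (C s.bond) + dist1 (corrHol C A γ) ≤ a + γ.length * a := by linarith
        gcongr
      rw [List.length_cons, Nat.cast_succ]
      have := hC' s.bond
      nlinarith

/-- [folklore] … with a length budget `|γ| ≤ n` (monotone in `n`; `t_C, t_A, a ≥ 0` follow from the letters on a nonempty bond type but are taken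
as hypotheses to keep the statement index-free). -/
theorem dist1_corrHol_quot_le_of_length_le (C C' A A' : GaugeField P j G) {a tC tA : ℝ} (ha0 : 0 ≤ a) (htC0 : 0 ≤ tC) (htA0 : 0 ≤ tA)
    (hC : ∀ b, dist1 (C b) ≤ a) (hC' : ∀ b, dist1 (C' b * (C b)⁻¹) ≤ tC) (hA : ∀ b, dist1 (A' b * (A b)⁻¹) ≤ tA)
    (γ : List (LStep P j)) {n : ℕ} (hn : γ.length ≤ n) :
    dist1 (corrHol C' A' γ * (corrHol C A γ)⁻¹) ≤ (n : ℝ) * tC + tA * a * ((n : ℝ) * (n + 1)) := by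
  refine (dist1_corrHol_quot_le hcomm C C' A A' hC hC' hA γ).trans ?_
  have hn' : (γ.length : ℝ) ≤ n := by exact_mod_cast hn
  have hl0 : (0 : ℝ) ≤ γ.length := Nat.cast_nonneg _
  have hmul : (γ.length : ℝ) * (γ.length + 1) ≤ (n : ℝ) * (n + 1) := by nlinarith
  have h1 : (γ.length : ℝ) * tC ≤ n * tC := mul_le_mul_of_nonneg_right hn' htC0
  have h2 : tA * a * ((γ.length : ℝ) * (γ.length + 1)) ≤ tA * a * ((n : ℝ) * (n + 1)) :=
    mul_le_mul_of_nonneg_left hmul (mul_nonneg htA0 ha0)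
  linarith

end Steps

/-! ## §3 Tower letters: the straight factors and the one-step recursion of the accumulated correction, in two fields -/

section Tower

variable {P : Params} {G : Type*} [GaugeGroup G] (ℰ : LoopAverage G)

/-- [folklore] **THE STRAIGHT FACTOR IN TWO FIELDS**: a finest bond-variation letter `dist1 (V′ b·(V b)⁻¹) ≤ t₀` gives
`dist1 ((axial)^j V′ (c) · ((axial)^j V (c))⁻¹) ≤ L^j·t₀` (the straight factor is the holonomy of the `L^j` finest bonds under `c`,
κ-L3 `axialTower_eq_holAt_walk`; first-order telescoping σ-L1 `dist1_holAt_walk_two_le`). -/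
theorem dist1_axialTower_quot_le (V V' : GaugeField P 0 G) {t₀ : ℝ} (hV : ∀ b : PBond P 0, dist1 (V' b * (V b)⁻¹) ≤ t₀) (j : ℕ) (c : PBond P j) :
    dist1 (axialTower V' j c * (axialTower V j c)⁻¹) ≤ (P.L : ℝ) ^ j * t₀ := by
  rw [axialTower_eq_holAt_walk V' j c, axialTower_eq_holAt_walk V j c]
  refine (dist1_holAt_walk_two_le V V' hV _ _).trans (le_of_eq ?_)
  rw [List.length_replicate, Nat.cast_pow]

/-- [folklore] the straight product along the line of a coarse bond in two fields: `dist1 (pathProd U′ c n·(pathProd U c n)⁻¹) ≤ Σ_{t<n} dist1 (U′(c_t)·U(c_t)⁻¹)`. -/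
theorem dist1_pathProd_quot_le {j : ℕ} (U U' : GaugeField P j G) (c : PBond P (j + 1)) (n : ℕ) :
    dist1 (pathProd U' c n * (pathProd U c n)⁻¹) ≤ ∑ t ∈ Finset.range n, dist1 (U' (line c t) * (U (line c t))⁻¹) := by
  rw [pathProd_eq_pprod, pathProd_eq_pprod]
  exact dist1_pprod_quot_le _ _ n

/-- [folklore] **THE ONE-STEP RECURSION OF THE ACCUMULATED CORRECTION IN TWO FIELDS** (sum form; twin of W-25a `dist1_corrAcc_succ_le`):
`dist1 (corrAcc′ (j+1) c·(corrAcc (j+1) c)⁻¹) ≤ dist1 (corr′_j c·(corr_j c)⁻¹)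
  + Σ_{t<L} (dist1 (corrAcc′ j (c_t)·(corrAcc j (c_t))⁻¹) + 2·dist1 (corrAcc j (c_t))·dist1 (Π′_t·Π_t⁻¹))`,
`Π_t` the straight product of the first `t` level-`j` straight factors under `c`, `corr_j = corr ℰ (avgTower ℰ V j)`. -/
theorem dist1_corrAcc_succ_quot_le (hcomm : ∀ a b : G, dist1 (a * b * a⁻¹ * b⁻¹) ≤ 2 * dist1 a * dist1 b)
    (V V' : GaugeField P 0 G) (j : ℕ) (c : PBond P (j + 1)) :
    dist1 (corrAcc ℰ V' (j + 1) c * (corrAcc ℰ V (j + 1) c)⁻¹) ≤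
      dist1 (corr ℰ (avgTower ℰ V' j) c * (corr ℰ (avgTower ℰ V j) c)⁻¹) +
        ∑ t ∈ Finset.range P.L, (dist1 (corrAcc ℰ V' j (line c t) * (corrAcc ℰ V j (line c t))⁻¹) +
          2 * dist1 (corrAcc ℰ V j (line c t)) *
            dist1 (pprod (fun s => axialTower V' j (line c s)) t * (pprod (fun s => axialTower V j (line c s)) t)⁻¹)) := by
  rw [corrAcc_succ, corrAcc_succ]
  exact (dist1_quot_mul_le _ _ _ _).trans (add_le_add le_rfl (dist1_conjAcc_quot_le hcomm _ _ _ _ _))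

/-- [folklore] **… uniform face**: with `dist1 (corrAcc j b) ≤ a_j`, `dist1 (corrAcc′ j b·(corrAcc j b)⁻¹) ≤ E_j` on the level-`j` bonds and the finest
bond-variation letter `t₀`, `dist1 (corrAcc′ (j+1) c·(corrAcc (j+1) c)⁻¹) ≤ dist1 (corr′_j c·(corr_j c)⁻¹) + L·E_j + 2·a_j·(L^j·t₀)·L²`. -/
theorem dist1_corrAcc_succ_quot_le_of_forall (hcomm : ∀ a b : G, dist1 (a * b * a⁻¹ * b⁻¹) ≤ 2 * dist1 a * dist1 b)
    (V V' : GaugeField P 0 G) (j : ℕ) {aj Ej t₀ : ℝ} (haj0 : 0 ≤ aj) (ht0 : 0 ≤ t₀)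
    (ha : ∀ b : PBond P j, dist1 (corrAcc ℰ V j b) ≤ aj) (hE : ∀ b : PBond P j, dist1 (corrAcc ℰ V' j b * (corrAcc ℰ V j b)⁻¹) ≤ Ej)
    (hV : ∀ b : PBond P 0, dist1 (V' b * (V b)⁻¹) ≤ t₀) (c : PBond P (j + 1)) :
    dist1 (corrAcc ℰ V' (j + 1) c * (corrAcc ℰ V (j + 1) c)⁻¹) ≤
      dist1 (corr ℰ (avgTower ℰ V' j) c * (corr ℰ (avgTower ℰ V j) c)⁻¹) + P.L * Ej + 2 * aj * ((P.L : ℝ) ^ j * t₀) * (P.L : ℝ) ^ 2 := by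
  rw [corrAcc_succ, corrAcc_succ, add_assoc]
  refine (dist1_quot_mul_le _ _ _ _).trans (add_le_add le_rfl ?_)
  exact dist1_conjAcc_quot_le_of_forall hcomm _ _ _ _ P.L haj0 (by positivity) (fun t _ => ha _) (fun t _ => hE _)
    (fun t _ => dist1_axialTower_quot_le V V' hV j _)

/-- [folklore] **THE ACCUMULATED CORRECTION IN TWO FIELDS UNDER DISPLAYED ONE-STEP LETTERS** (def-free twin of W-25a `dist1_corrAcc_le_accBound`):
if the level-`j` accumulated corrections of `V` are within `a_j ≥ 0` of `1` (W-25a: `a = accBound L κ` or `2κ∕(L^(K−j))²`), every one-step correction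
factor varies between the two fields by at most `κ₁ j` (`dist1 (corr′_j c·(corr_j c)⁻¹) ≤ κ₁ j` — σ-END's letter, produced level by level), the finest
bonds vary by at most `t₀ ≥ 0`, and `E : ℕ → ℝ` is ANY majorant of the recursion `E 0 ≥ 0`, `κ₁ j + L·E j + 2·a_j·(L^j·t₀)·L² ≤ E (j+1)`, then
`dist1 (corrAcc′ j c·(corrAcc j c)⁻¹) ≤ E j` at every level (induction on `dist1_corrAcc_succ_quot_le_of_forall`). -/
theorem dist1_corrAcc_quot_le_of_rec (hcomm : ∀ a b : G, dist1 (a * b * a⁻¹ * b⁻¹) ≤ 2 * dist1 a * dist1 b)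
    (V V' : GaugeField P 0 G) {t₀ : ℝ} (ht0 : 0 ≤ t₀) (hV : ∀ b : PBond P 0, dist1 (V' b * (V b)⁻¹) ≤ t₀)
    {a κ₁ E : ℕ → ℝ} (ha0 : ∀ j, 0 ≤ a j) (ha : ∀ (j : ℕ) (b : PBond P j), dist1 (corrAcc ℰ V j b) ≤ a j)
    (hκ₁ : ∀ (j : ℕ) (c : PBond P (j + 1)), dist1 (corr ℰ (avgTower ℰ V' j) c * (corr ℰ (avgTower ℰ V j) c)⁻¹) ≤ κ₁ j)
    (hE0 : 0 ≤ E 0) (hE : ∀ j, κ₁ j + P.L * E j + 2 * a j * ((P.L : ℝ) ^ j * t₀) * (P.L : ℝ) ^ 2 ≤ E (j + 1)) :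
    ∀ (j : ℕ) (c : PBond P j), dist1 (corrAcc ℰ V' j c * (corrAcc ℰ V j c)⁻¹) ≤ E j
  | 0, c => by rw [SubstrateAvgTowerStructure.corrAcc_zero, SubstrateAvgTowerStructure.corrAcc_zero, inv_one, mul_one, GaugeGroup.dist1_one]; exact hE0
  | j + 1, c => by
      refine le_trans ?_ (hE j)
      refine (dist1_corrAcc_succ_quot_le_of_forall ℰ hcomm V V' j (ha0 j) ht0 (ha j)
        (fun b => dist1_corrAcc_quot_le_of_rec hcomm V V' ht0 hV ha0 ha hκ₁ hE0 hE j b) hV c).trans ?_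
      exact add_le_add (add_le_add (hκ₁ j c) le_rfl) le_rfl

end Tower

/-! ## §4 The (0.4) loop variables of the averaging tower in two fields -/

section Avg

variable {P : Params} {G : Type*} [GaugeGroup G] (ℰ : LoopAverage G)

/-- [folklore] **THE REFINED-LOOP FACTORISATION FOR DIFFERENCES**: for two finest fields `V`, `V′`, the two-field quotient of the (0.4) loop variable of
the averaging towers at the coarse bond `c` of step `i → i+1` splits into the quotient of κ-L3's conjugated correction products along the level-`i`
loop walk and the quotient of the finest holonomies along the REFINED loop walk (κ-L3 `loopHol_avgTower_eq` for both fields, σ-L1 `dist1_quot_mul_le`). -/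
theorem dist1_loopHol_avgTower_quot_le (V V' : GaugeField P 0 G) (i : ℕ) (c : PBond P (i + 1)) (r : Idx P) :
    dist1 (loopHol (avgTower ℰ V' i) c r * (loopHol (avgTower ℰ V i) c r)⁻¹) ≤
      dist1 (corrHol (corrAcc ℰ V' i) (axialTower V' i) (walk (emb c.src) (loopWord P.L c.dir (off r.1) r.2.1 r.2.2)) *
          (corrHol (corrAcc ℰ V i) (axialTower V i) (walk (emb c.src) (loopWord P.L c.dir (off r.1) r.2.1 r.2.2)))⁻¹) +
        dist1 (holAt V' (walk (embIter (i + 1) c.src) (loopWord (P.L ^ (i + 1)) c.dir (fun ν => ((P.L : ℤ) ^ i) * off r.1 ν) r.2.1 r.2.2)) *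
          (holAt V (walk (embIter (i + 1) c.src) (loopWord (P.L ^ (i + 1)) c.dir (fun ν => ((P.L : ℤ) ^ i) * off r.1 ν) r.2.1 r.2.2)))⁻¹) := by
  rw [loopHol_avgTower_eq, loopHol_avgTower_eq]
  exact dist1_quot_mul_le _ _ _ _

/-- [folklore] **… uniform face (the shape σ-END consumes)**: under the commutator hypothesis, a level-`i` accumulated-correction budget `dist1 (corrAcc ℰ V i b) ≤ a`
(W-25a `dist1_corrAcc_le_of_hκ`: `a = 2κ∕(L^(K−i))²`), its two-field variation `dist1 (corrAcc′ i b·(corrAcc i b)⁻¹) ≤ t_C` (σ-END's induction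
hypothesis) and the straight-factor variation `dist1 ((axial)^i V′ b·((axial)^i V b)⁻¹) ≤ t_A` (`dist1_axialTower_quot_le`: `t_A = L^i·t₀`),
`dist1 (loopHol U′_i c r·(loopHol U_i c r)⁻¹) ≤ (d+2)L·t_C + t_A·a·((d+2)L·((d+2)L+1)) + Δ`, `Δ` the two-field quotient of the finest holonomies
along the refined loop walk (σ-L1 FILE 2's END applies to it; DISPLAYED here). -/
theorem dist1_loopHol_avgTower_quot_le_of_forall (hcomm : ∀ a b : G, dist1 (a * b * a⁻¹ * b⁻¹) ≤ 2 * dist1 a * dist1 b)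
    (V V' : GaugeField P 0 G) (i : ℕ) {a tC tA : ℝ} (ha : ∀ b : PBond P i, dist1 (corrAcc ℰ V i b) ≤ a)
    (hC : ∀ b : PBond P i, dist1 (corrAcc ℰ V' i b * (corrAcc ℰ V i b)⁻¹) ≤ tC)
    (hA : ∀ b : PBond P i, dist1 (axialTower V' i b * (axialTower V i b)⁻¹) ≤ tA) (c : PBond P (i + 1)) (r : Idx P) :
    dist1 (loopHol (avgTower ℰ V' i) c r * (loopHol (avgTower ℰ V i) c r)⁻¹) ≤
      (((P.d + 2) * P.L : ℕ) : ℝ) * tC + tA * a * ((((P.d + 2) * P.L : ℕ) : ℝ) * (((P.d + 2) * P.L : ℕ) + 1)) +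
        dist1 (holAt V' (walk (embIter (i + 1) c.src) (loopWord (P.L ^ (i + 1)) c.dir (fun ν => ((P.L : ℤ) ^ i) * off r.1 ν) r.2.1 r.2.2)) *
          (holAt V (walk (embIter (i + 1) c.src) (loopWord (P.L ^ (i + 1)) c.dir (fun ν => ((P.L : ℤ) ^ i) * off r.1 ν) r.2.1 r.2.2)))⁻¹) := by
  have hb : PBond P i := ⟨default, ⟨0, P.hd⟩⟩
  have ha0 : 0 ≤ a := (GaugeGroup.dist1_nonneg _).trans (ha hb)
  have htC0 : 0 ≤ tC := (GaugeGroup.dist1_nonneg _).trans (hC hb)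
  have htA0 : 0 ≤ tA := (GaugeGroup.dist1_nonneg _).trans (hA hb)
  refine (dist1_loopHol_avgTower_quot_le ℰ V V' i c r).trans (add_le_add ?_ le_rfl)
  refine dist1_corrHol_quot_le_of_length_le hcomm _ _ _ _ ha0 htC0 htA0 ha hC hA _ ?_
  rw [T4AvgDerivBound.length_walk]
  exact length_loopWord_off_le c.dir r.1 r.2.1 r.2.2

end Avg

end Summit.QuantumFields.BalabanUV.T4Continuum.B13AvgCorrRefineVariation

end
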